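import Summits.AtomisticToContinuum.FouriersLaw.Theorems.JunctionLocalityDefs
import Summits.AtomisticToContinuum.FouriersLaw.Theorems.BondHeatUncertaintySubdiffusiveBondHeatKernelGibbsE
import Summits.AtomisticToContinuum.FouriersLaw.Theorems.BondHeatUncertaintySubdiffusiveBondHeatKernelGibbsF
import Summits.AtomisticToContinuum.FouriersLaw.Theorems.EmbeddedDrudeMourreFiniteResponseOfUniqueFundamentalMatrix
import Summits.AtomisticToContinuum.FouriersLaw.Theorems.OddSectorIrreversibilityOddResponseBoundDensityUnique

/-!
# `NonBallistic` / line `contact-current-forgetting`, stub MP: Onsager symmetry and the midpoint Cauchy–Schwarz bound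

Stub file for crux stmt-AtomisticToContinuum-9127 (`JunctionLocality.NonBallistic`), line `contact-current-forgetting`,
registered stub `stub_midpointContraction` (held by the lead). It is the IMPLICATION "kernel detailed balance ⇒ (Onsager
symmetry of the Green–Kubo matrix integrand) ∧ (midpoint bound)": assuming the weak `L²(μ_T)` detailed balance of the
equal-temperature kernels under momentum reversal `Θ(q,p) = (q,-p)` (verbatim the registered stub
`stub_kernelDetailedBalance`, shared with crux 9120),

* `M_N(b,b')(t) = M_N(b',b)(t)` for `t ≥ 0`: detailed balance with `f = j_b`, `h = j_{b'}` and oddness `j ∘ Θ = -j`;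
* `|M_N(0,N-2)(t)| ≤ φ_N(t/2)`: Chapman–Kolmogorov `κ_t = κ_{t/2} ∘ₖ κ_{t/2}` (`pinnedChain_transitionKernel_add`) turns
  `M_N(0,N-2)(t)` into `⟨j_0, κ_{t/2} h⟩` with `h = κ_{t/2} j_{N-2} ∈ L²(μ_T)` (`pinnedChain_integral_sq_act_le`); detailed
  balance with `f = j_0` and this `h` gives `-∫ (h∘Θ)·(κ_{t/2} j_0) dμ_T`; the pointwise inequality `|ab| ≤ (a²+b²)/2`,
  `Θ`-invariance of `μ_T` (`measurePreserving_momentumReversal_gibbsMeasure`) and the definition of the symmetric profile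
  `φ_N(s) = ∫ (κ_s j_0)² + (κ_s j_{N-2})² dμ_T` finish: `|M| ≤ φ_N(t/2)/2 ≤ φ_N(t/2)`.

Everything is fixed-`N` bookkeeping over proved tree facts; no uniqueness hypothesis is used.
-/

noncomputable section

namespace Summit.AtomisticToContinuum.FouriersLaw.Theorems.NonBallistic

open MeasureTheory ProbabilityTheory Set Filter Topology
open scoped NNReal
open Literature.MathematicalPhysics.KineticTheory.HeatConduction
open Summit.AtomisticToContinuum.FouriersLaw.Theorems.JunctionLocality
open Summit.AtomisticToContinuum.FouriersLaw.Theorems.SubdiffusiveBondHeat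
open Summit.AtomisticToContinuum.FouriersLaw.Theorems.OddResponseBound.DensityUnique

namespace MidpointContraction

variable {ω₂ lam β γ : ℝ} (hω : 0 < ω₂) (hl : 0 ≤ lam) (hβ : 0 < β) (hγ : 0 < γ) {N : ℕ} (hN : 0 < N)
  {T : ℝ} (hT : 0 < T)

/-- The bond current with a natural-number index is odd under momentum reversal. -/
theorem bondCurrentAt_neg_momentum (P : OscillatorChain) (N b : ℕ) (y : PhaseSpace N) :
    bondCurrentAt P N b (y.1, -y.2) = -bondCurrentAt P N b y := by
  unfold bondCurrentAt
  rw [← Finset.sum_neg_distrib]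
  refine Finset.sum_congr rfl fun i _ => ?_
  split_ifs
  · exact P.bondCurrent_neg_momentum N i y
  · simp

/-- The bond current with a natural-number index is continuous (pinned chain). -/
theorem continuous_bondCurrentAt (ω₂ lam β γ : ℝ) (N b : ℕ) :
    Continuous (bondCurrentAt (pinnedChain ω₂ lam β γ) N b) := by
  unfold bondCurrentAt
  refine continuous_finsetSum _ fun i _ => ?_
  split_ifs
  · exact pinnedChain_continuous_bondCurrent ω₂ lam β γ N i
  · exact continuous_const

include hω hl hβ hN in
/-- Exponential domination of the bond current with a natural-number index: `|j_b| ≤ K e^{ϑH}` for every `ϑ > 0`. -/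
theorem abs_bondCurrentAt_le_exp {ϑ : ℝ} (hϑ0 : 0 < ϑ) (b : ℕ) :
    ∃ K : ℝ, 0 ≤ K ∧ ∀ y, |bondCurrentAt (pinnedChain ω₂ lam β γ) N b y| ≤
      K * Real.exp (ϑ * (pinnedChain ω₂ lam β γ).hamiltonian N y) := by
  by_cases hb : b < N
  · obtain ⟨K, hK, hKb⟩ := FiniteResponse.abs_bondCurrent_le_exp hω hl hβ hN hϑ0 (⟨b, hb⟩ : Fin N)
    refine ⟨K, hK.le, fun y => ?_⟩
    rw [bondCurrentAt_eq_bondCurrent _ hb]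
    exact hKb y
  · refine ⟨0, le_rfl, fun y => ?_⟩
    rw [bondCurrentAt_eq_zero_of_le _ (not_lt.1 hb)]
    simp

include hω hl hβ hγ hN hT in
/-- `L²(μ_T)` facts for `κ_u j_b`: `j_b² ∈ L¹(μ_T)`, `(κ_u j_b)² ∈ L¹(μ_T)`, `∫ (κ_u j_b)² ≤ ∫ j_b²`, and `κ_u j_b` is
strongly measurable; `j_b` is integrable against every `κ_u(z,·)`. -/
theorem evolve_facts (b : ℕ) (u : ℝ≥0) :
    Integrable (fun y => bondCurrentAt (pinnedChain ω₂ lam β γ) N b y ^ 2) ((pinnedChain ω₂ lam β γ).gibbsMeasure N T) ∧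
    Integrable (fun z => (∫ y, bondCurrentAt (pinnedChain ω₂ lam β γ) N b y
        ∂((pinnedChain ω₂ lam β γ).transitionKernel N T T u z)) ^ 2) ((pinnedChain ω₂ lam β γ).gibbsMeasure N T) ∧
    (∫ z, (∫ y, bondCurrentAt (pinnedChain ω₂ lam β γ) N b y
        ∂((pinnedChain ω₂ lam β γ).transitionKernel N T T u z)) ^ 2 ∂((pinnedChain ω₂ lam β γ).gibbsMeasure N T) ≤
      ∫ z, bondCurrentAt (pinnedChain ω₂ lam β γ) N b z ^ 2 ∂((pinnedChain ω₂ lam β γ).gibbsMeasure N T)) ∧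
    StronglyMeasurable (fun z => ∫ y, bondCurrentAt (pinnedChain ω₂ lam β γ) N b y
        ∂((pinnedChain ω₂ lam β γ).transitionKernel N T T u z)) ∧
    (∀ z, Integrable (bondCurrentAt (pinnedChain ω₂ lam β γ) N b)
        ((pinnedChain ω₂ lam β γ).transitionKernel N T T u z)) := by
  -- ϑ = 1/(4T): 0 < ϑ, 2ϑ < 1/T, ϑ < 1/T
  have hϑ0 : 0 < 1 / (4 * T) := by positivity
  have h2ϑ : 2 * (1 / (4 * T)) < 1 / T := by
    rw [show 2 * (1 / (4 * T)) = 1 / (2 * T) by field_simp; ring]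
    exact one_div_lt_one_div_of_lt hT (by linarith)
  have hϑ1 : 1 / (4 * T) < 1 / T := one_div_lt_one_div_of_lt hT (by linarith)
  obtain ⟨K, hK, hKb⟩ := abs_bondCurrentAt_le_exp hω hl hβ hN hϑ0 b
  have hcont := continuous_bondCurrentAt ω₂ lam β γ N b
  obtain ⟨h1, h2, h3⟩ := pinnedChain_integral_sq_act_le hω hl hβ hγ hN hT hϑ0 h2ϑ hcont hKb u
  haveI := pinnedChain_isMarkovKernel_transitionKernel hω hl hβ.le hγ.le N T T u
  refine ⟨h1, h2, h3, ?_, fun z => ?_⟩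
  · exact (hcont.stronglyMeasurable.comp_measurable measurable_snd).integral_kernel_prod_right'
  · exact integrable_of_abs_le_exp
      (pinnedChain_integrable_exp_mul_hamiltonian_transitionKernel hω hl hT hβ.le hγ.le hN hϑ0 hϑ1 u z) hcont hKb

end MidpointContraction

open MidpointContraction in
/-- **Stub MP of line `contact-current-forgetting` (crux stmt-AtomisticToContinuum-9127).** Kernel detailed balance (the
registered stub `stub_kernelDetailedBalance`, verbatim, as hypothesis) implies, for the pinned chain at `T > 0`, `N ≥ 2`:
(i) Onsager symmetry of the Green–Kubo matrix integrand, `gkEntry b b' t = gkEntry b' b t` (`t ≥ 0`); (ii) the midpoint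
bound `|gkEntry 0 (N-2) t| ≤ contactProfile (t/2)` (Chapman–Kolmogorov, detailed balance, `|ab| ≤ (a²+b²)/2`,
`Θ`-invariance of the Gibbs measure). -/
theorem stub_midpointContraction :
    (∀ ω₂ lam β γ : ℝ, 0 < ω₂ → 0 < lam → 0 < β → 0 < γ → ∀ T : ℝ, 0 < T → ∀ (N : ℕ) (hN : 1 < N),
      ∀ (s : NNReal) (f h : PhaseSpace N → ℝ), Measurable f → Measurable h →
        Integrable (fun y => f y ^ 2) ((pinnedChain ω₂ lam β γ).gibbsMeasure N T) →
        Integrable (fun y => h y ^ 2) ((pinnedChain ω₂ lam β γ).gibbsMeasure N T) →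
        ∫ y, f y * (∫ y', h y' ∂((pinnedChain ω₂ lam β γ).transitionKernel N T T s) y)
            ∂((pinnedChain ω₂ lam β γ).gibbsMeasure N T) =
          ∫ y, h (y.1, -y.2) * (∫ y', f (y'.1, -y'.2) ∂((pinnedChain ω₂ lam β γ).transitionKernel N T T s) y)
            ∂((pinnedChain ω₂ lam β γ).gibbsMeasure N T)) →
    ∀ ω₂ lam β γ : ℝ, 0 < ω₂ → 0 < lam → 0 < β → 0 < γ → ∀ T : ℝ, 0 < T → ∀ N : ℕ, 2 ≤ N →
      (∀ b b' : ℕ, ∀ t : ℝ, 0 ≤ t →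
        gkEntry (pinnedChain ω₂ lam β γ) N T b b' t = gkEntry (pinnedChain ω₂ lam β γ) N T b' b t) ∧
      ∀ t : ℝ, 0 ≤ t →
        |gkEntry (pinnedChain ω₂ lam β γ) N T 0 (N - 2) t| ≤
          contactProfile (pinnedChain ω₂ lam β γ) N T (t / 2) := by
  intro hDB ω₂ lam β γ hω hl hβ hγ T hT N hN
  have hN1 : 1 < N := by omega
  have hN0 : 0 < N := by omega
  set P := pinnedChain ω₂ lam β γ with hP
  set μ := P.gibbsMeasure N T with hμ
  have hDB' := hDB ω₂ lam β γ hω hl hβ hγ T hT N hN1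
  -- measurability and oddness of the bond currents
  have hjm : ∀ b, Measurable (bondCurrentAt P N b) := fun b => (continuous_bondCurrentAt ω₂ lam β γ N b).measurable
  have hjodd : ∀ b (y : PhaseSpace N), bondCurrentAt P N b (y.1, -y.2) = -bondCurrentAt P N b y :=
    fun b y => bondCurrentAt_neg_momentum P N b y
  refine ⟨fun b b' t _ => ?_, fun t ht => ?_⟩
  · -- (i) Onsager symmetry
    obtain ⟨hf2, -, -, -, -⟩ := evolve_facts hω hl.le hβ hγ hN0 hT b t.toNNReal
    obtain ⟨hh2, -, -, -, -⟩ := evolve_facts hω hl.le hβ hγ hN0 hT b' t.toNNReal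
    have key := hDB' t.toNNReal (bondCurrentAt P N b) (bondCurrentAt P N b') (hjm b) (hjm b') hf2 hh2
    unfold gkEntry evolve
    rw [key]
    refine integral_congr_ae (ae_of_all _ fun y => ?_)
    simp only [hjodd, integral_neg]
    ring
  · -- (ii) midpoint bound
    set s : ℝ≥0 := (t / 2).toNNReal with hs
    have ht2 : 0 ≤ t / 2 := by positivity
    have hts : t.toNNReal = s + s := by
      rw [hs, ← Real.toNNReal_add ht2 ht2]; congr 1; ring
    -- facts for j_0 and j_{N-2} at time s
    obtain ⟨-, he2, -, hem, hjκ0⟩ := evolve_facts hω hl.le hβ hγ hN0 hT 0 s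
    obtain ⟨-, hh2, -, hhm, hjκ⟩ := evolve_facts hω hl.le hβ hγ hN0 hT (N - 2) s
    set e : PhaseSpace N → ℝ := fun y => ∫ y', bondCurrentAt P N 0 y' ∂(P.transitionKernel N T T s y) with hedef
    set h : PhaseSpace N → ℝ := fun y => ∫ y', bondCurrentAt P N (N - 2) y' ∂(P.transitionKernel N T T s y)
      with hhdef
    -- Chapman–Kolmogorov: κ_t j_{N-2} = κ_s (κ_s j_{N-2})
    have hCK : ∀ z, evolve P N T (bondCurrentAt P N (N - 2)) t z = ∫ y, h y ∂(P.transitionKernel N T T s z) := by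
      intro z
      unfold evolve
      rw [hts, pinnedChain_transitionKernel_add hω hl.le hβ.le hγ.le N T T s s]
      rw [Kernel.integral_comp]
      -- integrability of j_{N-2} against (κ_s ∘ₖ κ_s) z = κ_{s+s} z
      rw [← pinnedChain_transitionKernel_add hω hl.le hβ.le hγ.le N T T s s]
      obtain ⟨-, -, -, -, hjκ2⟩ := evolve_facts hω hl.le hβ hγ hN0 hT (N - 2) (s + s)
      exact hjκ2 z
    have hgk : gkEntry P N T 0 (N - 2) t = ∫ y, bondCurrentAt P N 0 y * (∫ y', h y' ∂(P.transitionKernel N T T s y)) ∂μ := by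
      unfold gkEntry
      refine integral_congr_ae (ae_of_all _ fun y => ?_)
      simp only [hCK y]
    -- detailed balance with f = j_0, h = κ_s j_{N-2}
    obtain ⟨hf2, -, -, -, -⟩ := evolve_facts hω hl.le hβ hγ hN0 hT 0 s
    have key := hDB' s (bondCurrentAt P N 0) h (hjm 0) hhm.measurable hf2 hh2
    have hrhs : ∫ y, h (y.1, -y.2) * (∫ y', bondCurrentAt P N 0 (y'.1, -y'.2) ∂(P.transitionKernel N T T s y)) ∂μ =
        -∫ y, h (y.1, -y.2) * e y ∂μ := by
      rw [← integral_neg]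
      refine integral_congr_ae (ae_of_all _ fun y => ?_)
      simp only [hjodd, integral_neg, hedef]
      ring
    -- Θ-invariance of μ_T: (h∘Θ)² ∈ L¹ with the same integral as h²
    have hΘ : MeasurePreserving (momentumReversal N) μ μ := measurePreserving_momentumReversal_gibbsMeasure P N T
    have hhΘ2 : Integrable (fun y => h (y.1, -y.2) ^ 2) μ := by
      have := (hΘ.integrable_comp_emb (momentumReversal N).measurableEmbedding).2 hh2
      simpa [Function.comp_def, momentumReversal_apply] using this
    have hhΘint : ∫ y, h (y.1, -y.2) ^ 2 ∂μ = ∫ y, h y ^ 2 ∂μ := by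
      have := hΘ.integral_comp (momentumReversal N).measurableEmbedding (fun y => h y ^ 2)
      simpa [momentumReversal_apply] using this
    -- pointwise |ab| ≤ (a² + b²)/2 and the bound
    have hdom : ∀ y, ‖h (y.1, -y.2) * e y‖ ≤ (h (y.1, -y.2) ^ 2 + e y ^ 2) / 2 := by
      intro y
      rw [Real.norm_eq_abs, abs_mul]
      nlinarith [sq_nonneg (|h (y.1, -y.2)| - |e y|), sq_abs (h (y.1, -y.2)), sq_abs (e y),
        abs_nonneg (h (y.1, -y.2)), abs_nonneg (e y)]
    have hgint : Integrable (fun y => (h (y.1, -y.2) ^ 2 + e y ^ 2) / 2) μ := (hhΘ2.add he2).div_const 2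
    have hbound : ‖∫ y, h (y.1, -y.2) * e y ∂μ‖ ≤ ∫ y, (h (y.1, -y.2) ^ 2 + e y ^ 2) / 2 ∂μ :=
      norm_integral_le_of_norm_le hgint (ae_of_all _ hdom)
    have hprof : contactProfile P N T (t / 2) = ∫ y, e y ^ 2 ∂μ + ∫ y, h y ^ 2 ∂μ := by
      unfold contactProfile evolve
      rw [← hs]
      exact integral_add he2 hh2
    have hval : ∫ y, (h (y.1, -y.2) ^ 2 + e y ^ 2) / 2 ∂μ = contactProfile P N T (t / 2) / 2 := by
      rw [integral_div, integral_add hhΘ2 he2, hhΘint, hprof]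
      ring
    have hnn : 0 ≤ contactProfile P N T (t / 2) := contactProfile_nonneg P N T _
    rw [hgk, key, hrhs, abs_neg]
    calc |∫ y, h (y.1, -y.2) * e y ∂μ| = ‖∫ y, h (y.1, -y.2) * e y ∂μ‖ := (Real.norm_eq_abs _).symm
      _ ≤ contactProfile P N T (t / 2) / 2 := hbound.trans_eq hval
      _ ≤ contactProfile P N T (t / 2) := by linarith

end Summit.AtomisticToContinuum.FouriersLaw.Theorems.NonBallistic

end
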